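import Literature.NumberTheory.Transcendental.QuadraticRelationsLogarithmsThm11
import Mathlib.LinearAlgebra.FreeModule.PID
import Mathlib.LinearAlgebra.Matrix.Basis
import HarnessLib

/-!
# Roy–Waldschmidt 1997, §6 infrastructure: integral frames of subspaces defined over `ℚ`

Towards the category `𝒞` of §6 of D. Roy, M. Waldschmidt, *Approximation diophantienne et
indépendance algébrique de logarithmes*, Ann. Sci. ÉNS (4) 30 (1997) 753–796 (pp. 785–786): its
kernels (6.2) and cokernels (6.3) have to be built with **integer** matrices on the `𝐆_m`-part
(an object carries a subgroup `Y ⊆ K^{d₀} × 𝓛_K^{d₁}`, and `exp` of an *integer* combination of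
logarithms of elements of `K^×` is again in `K^×`).  This file provides the necessary lattice
statement, a form of the adapted-basis theorem for saturated sublattices of `ℤ^m`:

* `RoyWaldschmidt1997.exists_integral_frame` — for a subspace `S ⊆ ℂ^m` defined over `ℚ` of
  dimension `k` there are integer matrices `A (m×k), B (k×m), C ((m-k)×m), D (m×(m-k))` with
  `BA = 1`, `CD = 1`, `CA = 0`, `BD = 0`, `AB + DC = 1` and `S = ℂ·(columns of A)`; i.e.
  `ℤ^m = Aℤ^k ⊕ Dℤ^{m-k}` with `Aℤ^k = S ∩ ℤ^m`, `B` an integral retraction onto it and `C` an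
  integral surjection `ℤ^m → ℤ^{m-k}` with kernel `S ∩ ℤ^m`.

Proof: `Λ = S ∩ ℤ^m` is saturated, so in a Smith normal form of `Λ ≤ ℤ^m` (Mathlib
`Submodule.smithNormalForm`) the adapted basis vectors `bM (f i)` themselves lie in `Λ` and span
it; the change-of-basis matrices and the splitting of the adapted basis into `range f` and its
complement give `A, B, C, D`; `S = ℂΛ` because `S` is spanned by rational vectors, and
`dim_ℂ ℂΛ = rank Λ` (`finrank_span_intCast`).  No definitions, no named facts.

## References

* [RoyWaldschmidt1997ENS] D. Roy, M. Waldschmidt, Ann. Sci. ÉNS (4) 30 (1997) 753–796, §6 (i),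
  pp. 785–786 (kernels (6.2) and cokernels (6.3) of the category `𝒞`).
-/

noncomputable section

open Module Submodule

namespace Literature.NumberTheory.Transcendental

namespace RoyWaldschmidt1997

open LiePresentation

variable {m : ℕ}

/-- The coordinatewise cast `ℤ^m → ℂ^m` as a `ℤ`-linear map (local tool). [folklore] -/
theorem exists_intCastMap (m : ℕ) :
    ∃ ι : (Fin m → ℤ) →ₗ[ℤ] (Fin m → ℂ), ∀ z i, ι z i = (z i : ℂ) :=
  ⟨{ toFun := fun z i => (z i : ℂ), map_add' := fun z w => by funext i; simp,
     map_smul' := fun c z => by funext i; simp }, fun _ _ => rfl⟩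

/-- **Integral frame of a subspace defined over `ℚ`.**  For `S ⊆ ℂ^m` defined over `ℚ`, of
dimension `k`, there are integer matrices `A, B, C, D` with `BA = 1`, `CD = 1`, `CA = 0`,
`BD = 0`, `AB + DC = 1`, and `S` is the `ℂ`-span of the columns of `A`. [folklore] -/
theorem exists_integral_frame (S : Submodule ℂ (Fin m → ℂ)) (hS : IsKRational ℚ S) :
    ∃ (k : ℕ) (A : Matrix (Fin m) (Fin k) ℤ) (B : Matrix (Fin k) (Fin m) ℤ)
      (C : Matrix (Fin (m - k)) (Fin m) ℤ) (D : Matrix (Fin m) (Fin (m - k)) ℤ),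
      k ≤ m ∧ B * A = 1 ∧ C * D = 1 ∧ C * A = 0 ∧ B * D = 0 ∧ A * B + D * C = 1 ∧
      Module.finrank ℂ S = k ∧
      S = span ℂ (Set.range fun j : Fin k => fun i => ((A i j : ℤ) : ℂ)) := by
  classical
  obtain ⟨ι, hι⟩ := exists_intCastMap m
  -- the saturated lattice `Λ = S ∩ ℤ^m`
  set Λ : Submodule ℤ (Fin m → ℤ) := (S.restrictScalars ℤ).comap ι with hΛ
  have hmemΛ : ∀ z, z ∈ Λ ↔ ι z ∈ S := fun z => Iff.rfl
  have hsat : ∀ (n : ℤ) (z : Fin m → ℤ), n ≠ 0 → n • z ∈ Λ → z ∈ Λ := by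
    intro n z hn hz
    rw [hmemΛ] at hz ⊢
    have : ι z = (n : ℂ)⁻¹ • ι (n • z) := by
      rw [map_zsmul ι, zsmul_eq_mul]
      funext i
      simp only [Pi.smul_apply, Pi.mul_apply, smul_eq_mul]
      rw [show ((n : Fin m → ℂ) i) = (n : ℂ) from rfl, ← mul_assoc, inv_mul_cancel₀ (by exact_mod_cast hn),
        one_mul]
    rw [this]
    exact S.smul_mem _ hz
  -- Smith normal form of `Λ ≤ ℤ^m`; saturation forces the elementary divisors to be units
  obtain ⟨k, snf⟩ := Submodule.smithNormalForm (Pi.basisFun ℤ (Fin m)) Λ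
  set bM := snf.bM with hbM
  set f := snf.f with hf
  have hfmem : ∀ i, bM (f i) ∈ Λ := by
    intro i
    have hi : (snf.bN i : Fin m → ℤ) = snf.a i • bM (f i) := snf.snf i
    have ha : snf.a i ≠ 0 := by
      intro h0
      have : (snf.bN i : Fin m → ℤ) = 0 := by rw [hi, h0, zero_smul]
      exact snf.bN.ne_zero i (Subtype.ext this)
    refine hsat (snf.a i) (bM (f i)) ha ?_
    rw [← hi]; exact (snf.bN i).2
  have hΛle : Λ ≤ span ℤ (Set.range fun i => bM (f i)) := by
    intro x hx
    have hrepr := snf.bN.sum_repr ⟨x, hx⟩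
    have hx' : x = ∑ i, (snf.bN.repr ⟨x, hx⟩ i) • (snf.bN i : Fin m → ℤ) := by
      have := congrArg (fun l : Λ => (l : Fin m → ℤ)) hrepr
      rw [Submodule.coe_sum] at this
      simpa only [Submodule.coe_smul] using this.symm
    rw [hx']
    refine Submodule.sum_mem _ fun i _ => ?_
    rw [snf.snf i, smul_smul]
    exact Submodule.smul_mem _ _ (subset_span ⟨i, rfl⟩)
  have hli : LinearIndependent ℤ (fun i => bM (f i)) := bM.linearIndependent.comp f f.injective
  have hkm : k ≤ m := by simpa using Fintype.card_le_of_embedding f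
  -- the change-of-basis matrices `U` (columns `bM j`) and `P = U⁻¹`
  set U : Matrix (Fin m) (Fin m) ℤ := (Pi.basisFun ℤ (Fin m)).toMatrix bM with hU
  set P : Matrix (Fin m) (Fin m) ℤ := bM.toMatrix (Pi.basisFun ℤ (Fin m)) with hP
  have hPU : P * U = 1 := by rw [hP, hU, Basis.toMatrix_mul_toMatrix, Basis.toMatrix_self]
  have hUP : U * P = 1 := by rw [hP, hU, Basis.toMatrix_mul_toMatrix, Basis.toMatrix_self]
  have hU_apply : ∀ i j, U i j = bM j i := fun i j => by
    rw [hU, Basis.toMatrix_apply, Pi.basisFun_repr]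
  -- enumerate the complement of `range f`
  set rf : Finset (Fin m) := Finset.univ.map f with hrf
  have hcard : rfᶜ.card = m - k := by
    rw [Finset.card_compl, hrf, Finset.card_map, Finset.card_univ, Fintype.card_fin, Fintype.card_fin]
  let g : Fin (m - k) ↪o Fin m := rfᶜ.orderEmbOfFin hcard
  have hg_mem : ∀ l, g l ∈ rfᶜ := fun l => Finset.orderEmbOfFin_mem rfᶜ hcard l
  have hgf : ∀ l i, g l ≠ f i := by
    intro l i h
    have := hg_mem l
    rw [Finset.mem_compl, hrf] at this
    exact this (Finset.mem_map.mpr ⟨i, Finset.mem_univ _, h.symm⟩)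
  have hbij : Function.Bijective (Sum.elim f g) := by
    rw [Fintype.bijective_iff_injective_and_card]
    refine ⟨?_, by simp only [Fintype.card_sum, Fintype.card_fin]; omega⟩
    rintro (i | l) (i' | l') h
    · simp only [Sum.elim_inl] at h; rw [f.injective h]
    · simp only [Sum.elim_inl, Sum.elim_inr] at h; exact absurd h.symm (hgf l' i)
    · simp only [Sum.elim_inl, Sum.elim_inr] at h; exact absurd h (hgf l i')
    · simp only [Sum.elim_inr] at h; rw [g.injective h]
  have hsplit : ∀ F : Fin m → ℤ, ∑ x, F x = ∑ i, F (f i) + ∑ l, F (g l) := by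
    intro F
    rw [← Equiv.sum_comp (Equiv.ofBijective _ hbij), Fintype.sum_sum_type]
    rfl
  -- the four matrices
  set A : Matrix (Fin m) (Fin k) ℤ := fun i i' => U i (f i') with hA
  set B : Matrix (Fin k) (Fin m) ℤ := fun i' j => P (f i') j with hB
  set D : Matrix (Fin m) (Fin (m - k)) ℤ := fun i l => U i (g l) with hD
  set C : Matrix (Fin (m - k)) (Fin m) ℤ := fun l j => P (g l) j with hC
  have hPU_apply : ∀ x y, ∑ j, P x j * U j y = if x = y then 1 else 0 := by
    intro x y
    have := congrFun (congrFun hPU x) y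
    rw [Matrix.mul_apply, Matrix.one_apply] at this
    exact this
  -- `S = ℂ·(bM ∘ f)` and its dimension
  have hSeq : S = span ℂ (Set.range fun i' : Fin k => fun i => (((bM (f i')) i : ℤ) : ℂ)) := by
    refine le_antisymm ?_ (span_le.mpr ?_)
    · -- `S` is spanned by rational vectors, which are rational multiples of lattice vectors
      obtain ⟨s, hs⟩ := hS
      rw [hs]
      refine span_le.mpr ?_
      rintro _ ⟨v, hv, rfl⟩
      obtain ⟨N, hN, hZ⟩ := exists_common_den v
      choose z hz using hZ
      have hzi : ∀ i, ((z i : ℤ) : ℂ) = (N : ℂ) * ((v i : ℚ) : ℂ) := by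
        intro i
        have h' : ((z i : ℤ) : ℚ) = (N : ℚ) * v i := (hz i).symm
        have := congrArg (fun q : ℚ => (q : ℂ)) h'
        push_cast at this
        exact this
      have hzΛ : z ∈ Λ := by
        rw [hmemΛ]
        have : ι z = (N : ℂ) • ofK ℚ (L := ℂ) v := by
          funext i
          rw [hι, Pi.smul_apply, ofK_apply, smul_eq_mul, hzi i]
          simp [eq_ratCast]
        rw [this]
        refine S.smul_mem _ ?_
        rw [hs]; exact subset_span ⟨v, hv, rfl⟩
      -- `z` is a `ℤ`-combination of the `bM (f i)`, so `ι z` is in the span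
      have hιz : ι z ∈ span ℂ (Set.range fun i' : Fin k => fun i => (((bM (f i')) i : ℤ) : ℂ)) := by
        obtain ⟨c, hc⟩ := (Submodule.mem_span_range_iff_exists_fun ℤ).mp (hΛle hzΛ)
        have : ι z = ∑ i', ((c i' : ℤ) : ℂ) • fun i => (((bM (f i')) i : ℤ) : ℂ) :=
          calc ι z = ι (∑ i', c i' • bM (f i')) := by rw [hc]
            _ = ∑ i', ((c i' : ℤ) : ℂ) • fun i => (((bM (f i')) i : ℤ) : ℂ) := by
              rw [map_sum]
              refine Finset.sum_congr rfl fun i' _ => ?_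
              rw [LinearMap.map_smul]
              funext i
              simp [hι]
        rw [this]
        exact Submodule.sum_mem _ fun i' _ => Submodule.smul_mem _ _ (subset_span ⟨i', rfl⟩)
      have hv_eq : ofK ℚ (L := ℂ) v = (N : ℂ)⁻¹ • ι z := by
        funext i
        rw [Pi.smul_apply, hι, ofK_apply, smul_eq_mul, hzi i, ← mul_assoc,
          inv_mul_cancel₀ (by exact_mod_cast hN.ne'), one_mul]
        simp [eq_ratCast]
      rw [hv_eq]
      exact Submodule.smul_mem _ _ hιz
    · rintro _ ⟨i', rfl⟩
      have hj : bM (f i') ∈ Λ := hfmem i'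
      rw [hmemΛ] at hj
      have he : (fun i => (((bM (f i')) i : ℤ) : ℂ)) = ι (bM (f i')) := funext fun i => (hι _ i).symm
      show (fun i => (((bM (f i')) i : ℤ) : ℂ)) ∈ S
      rw [he]; exact hj
  have hspan := finrank_span_intCast (span ℤ (Set.range fun i => bM (f i))) (Basis.span hli)
  have hbspan : (fun i' : Fin k => fun i => ((((Basis.span hli i' : span ℤ (Set.range fun i => bM (f i))) :
      Fin m → ℤ) i : ℤ) : ℂ)) = fun i' => fun i => (((bM (f i')) i : ℤ) : ℂ) := by
    funext i' i
    rw [Basis.span_apply]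
  rw [hbspan] at hspan
  have hcol : (fun i' : Fin k => fun i => ((A i i' : ℤ) : ℂ)) = fun i' => fun i => (((bM (f i')) i : ℤ) : ℂ) := by
    funext i' i
    rw [hA]
    simp only [hU_apply]
  -- conclusion
  refine ⟨k, A, B, C, D, hkm, ?_, ?_, ?_, ?_, ?_, ?_, ?_⟩
  · ext i' i''
    rw [Matrix.mul_apply, Matrix.one_apply]
    simp only [hB, hA]
    rw [hPU_apply]
    by_cases h : i' = i''
    · subst h; simp
    · rw [if_neg (fun h' => h (f.injective h')), if_neg h]
  · ext l l'
    rw [Matrix.mul_apply, Matrix.one_apply]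
    simp only [hC, hD]
    rw [hPU_apply]
    by_cases h : l = l'
    · subst h; simp
    · rw [if_neg (fun h' => h (g.injective h')), if_neg h]
  · ext l i'
    rw [Matrix.mul_apply, Matrix.zero_apply]
    simp only [hC, hA]
    rw [hPU_apply, if_neg (hgf l i')]
  · ext i' l
    rw [Matrix.mul_apply, Matrix.zero_apply]
    simp only [hB, hD]
    rw [hPU_apply, if_neg (fun h => hgf l i' h.symm)]
  · ext i j
    rw [Matrix.add_apply, Matrix.mul_apply, Matrix.mul_apply, Matrix.one_apply]
    simp only [hA, hB, hD, hC]
    have := congrFun (congrFun hUP i) j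
    rw [Matrix.mul_apply, Matrix.one_apply] at this
    rw [← this, hsplit (fun x => U i x * P x j)]
  · rw [hSeq]; exact hspan.2
  · rw [hcol]; exact hSeq

end RoyWaldschmidt1997

end Literature.NumberTheory.Transcendental
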